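import Summits.AnomalousDissipation.AnomalousDissipation.Theorems.SolenoidalFractalHomogenisationLagrangianStepCellClauseModDefs
import HarnessLib

/-!
# K1L_D (stmt-AnomalousDissipation-27980): the MODULATED slow-vector cell clause WITH the coarse-member window binders — definitions
# (Summits-side defs file of route `SolenoidalFractalHomogenisation`; prover ad-sawtooth-k1loc-p1 g14; memo `K1loc-memo-v19-Vmod-cut` findings F-p1g14-1 and F-p1g14-2,
# companion of `…CellClauseModDefs` (p692853, lead-k1l-onelevel-p1) — that file is untouched)

`SlowVectorClauseModEC` (v2, capped transient) constrains the (V)-family member `𝔸` (`NearIso 𝔸 (ν lo/λ) (ν hi λ)`, `OddSmall 𝔸 (νβ)`) but says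
nothing about the COARSE member's enhancement `Φ ν ((1/ν)•𝔸)`.  The fast↔fast block of the clause, at generator level, needs the coarse member's
cell-scale damping to dominate the cell member's `O(1)` foreign-slot links (ratio `O(ν/(c·lo′))`, `lo′` the transversal lower constant of Φ's image):
for a word with a degenerate gain direction (planar two-slot word `m₁ = (1,0,0), ê₁ = (0,1,0)`, `m₂ = (0,1,0), ê₂ = (1,0,0)`, at `(k̂, p) = (m̂₁, m̂₂)`)
the clause is false uniformly in `ν → 0`.  At the §9z glue's call site the two facts `OddSmall (Φ ν S) β`, `NearIso (Φ ν S) lo hi` ARE binders of the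
§9z text, so the cure is free: this file defines

* `SlowVectorClauseModECW` — `SlowVectorClauseModEC` with the two Φ-image binders inserted after the `𝔸`-window binder, everything else VERBATIM;
* `SlowVectorClauseLossFlatW` — the same two binders added to the flat loss-currency clause `SlowVectorClauseLossFlat` (the `θ = 0`, `nC = 0`, `G ≡ 1`
  slice over ordinary propagators; the flat-stage target of the memo);
and proves the bridges `modECW_of_modEC` (drop the binders), `lossFlatW_of_lossFlat`, `lossFlatW_of_modECW` (consistency at `G ≡ 1`).
Definitions only + bridges; nothing about (V_mod), §9z, the crux or AD is proved here (rung F-D1.A0).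
[cite: ArmstrongVicol2025, §4.1 (PDF p. 34: the distortion-adapted comparison problem)]
-/

set_option linter.dupNamespace false  -- the summit-side namespace `Summit.AnomalousDissipation.AnomalousDissipation.…` repeats a component by design (D-0017)

noncomputable section

namespace Summit.AnomalousDissipation.AnomalousDissipation.Theorems.SolenoidalFractalHomogenisation.LagrangianStep.CellClauseMod

open Literature.Analysis Literature.Analysis.FluidPDE Literature.Analysis.FunctionSpaces
open MeasureTheory Set Filter UnitAddTorus
open scoped ENNReal NNReal InnerProductSpace

/-- **(V_modECW) — the modulated slow-vector clause, loss currency, capped transient, WITH the coarse-member window binders.**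
`SlowVectorClauseModEC` VERBATIM except for the two binders `Torus.OddSmall (Φ ν ((1/ν)•𝔸)) β →` and
`(∃ lam ∈ [1,Λ], Torus.NearIso (Φ ν ((1/ν)•𝔸)) (lo/lam) (hi·lam)) →` inserted after the `𝔸`-window binder (at the glue's instantiation
`𝔸 = ν•S`, `λ = λ′ = 1`, these are the §9z binders `OddSmall (Φ ν S) β`, `NearIso (Φ ν S) lo hi`).
[cite: ArmstrongVicol2025, §4.1 (PDF p. 34: the distortion-adapted comparison problem)] -/
def SlowVectorClauseModECW {k : ℕ} (W : LatticeShear.LatticeWord k) (M : ℝ) (hM : 0 < M) (c : ℝ)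
    (Φ : ℝ → Torus.Visc4 (Fin 3) → Torus.Visc4 (Fin 3)) (lo hi Λ β σ C ν₀ K θ₁ ϱ₁ : ℝ) : Prop :=
  ∀ ν, ∀ hν : ν ∈ Set.Ioo 0 ν₀, ∀ n : ℕ, (⌈K / ν⌉₊ : ℝ) ≤ n → ∀ 𝔸 : Torus.Visc4 (Fin 3),
    Torus.OddSmall 𝔸 (ν * β) → (∃ lam ∈ Set.Icc (1:ℝ) Λ, Torus.NearIso 𝔸 (ν * (lo / lam)) (ν * (hi * lam))) →
    Torus.OddSmall (Φ ν ((1 / ν) • 𝔸)) β → (∃ lam ∈ Set.Icc (1:ℝ) Λ, Torus.NearIso (Φ ν ((1 / ν) • 𝔸)) (lo / lam) (hi * lam)) →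
    ∀ θ ∈ Set.Icc 0 θ₁, ∀ nC : ℝ, 0 ≤ nC → nC ≤ ϱ₁ * n → ∀ Tw > (0:ℝ),
    ∀ G : ℝ → UnitAddTorus (Fin 3) → Matrix (Fin 3) (Fin 3) ℝ, IsModulation θ Tw nC G →
    ∀ U T : ℝ → ℝ → (V2 →L[ℝ] V2),
      IsDistortedPropagator Tw ((1 / (n:ℝ) ^ 2) • 𝔸) (cellField W M hM ν hν.1 n) G U →
      IsDistortedPropagator Tw ((1 / (n:ℝ) ^ 2) • (𝔸 + (c / ν) • Φ ν ((1 / ν) • 𝔸))) (fun _ _ => 0) G T →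
    ∀ s t : ℝ, 0 ≤ s → s < t → t ≤ Tw → ∀ x ζ : V2,
      |⟪U s t x - T s t x, ζ⟫_ℝ|
        ≤ (C * (C * (ν ^ σ + ((⌈K / ν⌉₊ : ℝ) / n) ^ σ + θ ^ σ + (nC / n) ^ σ) + (min 1 ((M * W.period / ν) / (t - s))) ^ σ))
          * Real.sqrt (lossFwd (T s t) x) * Real.sqrt (lossAdj (T s t) ζ)

/-- **(V_LossFlatW)** — the flat loss-currency clause `SlowVectorClauseLossFlat` with the same two Φ-image binders (ordinary propagators,
`η₀ = C(C(ν^σ + (⌈K/ν⌉/n)^σ) + (min 1 ((M·Wp/ν)/(t−s)))^σ)`, capped transient).  The flat-stage target of the (V_mod) lane. -/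
def SlowVectorClauseLossFlatW {k : ℕ} (W : LatticeShear.LatticeWord k) (M : ℝ) (hM : 0 < M) (c : ℝ)
    (Φ : ℝ → Torus.Visc4 (Fin 3) → Torus.Visc4 (Fin 3)) (lo hi Λ β σ C ν₀ K : ℝ) : Prop :=
  ∀ ν, ∀ hν : ν ∈ Set.Ioo 0 ν₀, ∀ n : ℕ, (⌈K / ν⌉₊ : ℝ) ≤ n → ∀ 𝔸 : Torus.Visc4 (Fin 3),
    Torus.OddSmall 𝔸 (ν * β) → (∃ lam ∈ Set.Icc (1:ℝ) Λ, Torus.NearIso 𝔸 (ν * (lo / lam)) (ν * (hi * lam))) →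
    Torus.OddSmall (Φ ν ((1 / ν) • 𝔸)) β → (∃ lam ∈ Set.Icc (1:ℝ) Λ, Torus.NearIso (Φ ν ((1 / ν) • 𝔸)) (lo / lam) (hi * lam)) →
    ∀ Tw > (0:ℝ), ∀ U T : ℝ → ℝ → (V2 →L[ℝ] V2),
      Torus.IsPropagator Tw (cellField W M hM ν hν.1 n) ((1 / (n:ℝ) ^ 2) • 𝔸) U →
      Torus.IsPropagator Tw (fun _ _ => 0) ((1 / (n:ℝ) ^ 2) • (𝔸 + (c / ν) • Φ ν ((1 / ν) • 𝔸))) T →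
    ∀ s t : ℝ, 0 ≤ s → s < t → t ≤ Tw → ∀ x ζ : V2,
      |⟪U s t x - T s t x, ζ⟫_ℝ|
        ≤ (C * (C * (ν ^ σ + ((⌈K / ν⌉₊ : ℝ) / n) ^ σ) + (min 1 ((M * W.period / ν) / (t - s))) ^ σ))
          * Real.sqrt (lossFwd (T s t) x) * Real.sqrt (lossAdj (T s t) ζ)

/-- `ModEC ⇒ ModECW` (drop the two Φ-image binders). -/
theorem modECW_of_modEC {k : ℕ} {W : LatticeShear.LatticeWord k} {M : ℝ} {hM : 0 < M} {c : ℝ}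
    {Φ : ℝ → Torus.Visc4 (Fin 3) → Torus.Visc4 (Fin 3)} {lo hi Λ β σ C ν₀ K θ₁ ϱ₁ : ℝ}
    (h : SlowVectorClauseModEC W M hM c Φ lo hi Λ β σ C ν₀ K θ₁ ϱ₁) :
    SlowVectorClauseModECW W M hM c Φ lo hi Λ β σ C ν₀ K θ₁ ϱ₁ :=
  fun ν hν n hn 𝔸 hodd hwin _ _ => h ν hν n hn 𝔸 hodd hwin

/-- **Consistency at `G ≡ 1`**: the modulated clause with binders implies the flat clause with binders (`θ = 0`, `nC = 0`; `0^σ = 0` for `σ > 0`). -/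
theorem lossFlatW_of_modECW {k : ℕ} {W : LatticeShear.LatticeWord k} {M : ℝ} {hM : 0 < M} {c : ℝ}
    {Φ : ℝ → Torus.Visc4 (Fin 3) → Torus.Visc4 (Fin 3)} {lo hi Λ β σ C ν₀ K θ₁ ϱ₁ : ℝ} (hσ : 0 < σ) (hθ₁ : 0 ≤ θ₁) (hϱ₁ : 0 ≤ ϱ₁)
    (h : SlowVectorClauseModECW W M hM c Φ lo hi Λ β σ C ν₀ K θ₁ ϱ₁) : SlowVectorClauseLossFlatW W M hM c Φ lo hi Λ β σ C ν₀ K := by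
  intro ν hν n hn 𝔸 hodd hwin hΦo hΦn Tw hTw U T hU hT s t hs hst htT x ζ
  have key := h ν hν n hn 𝔸 hodd hwin hΦo hΦn 0 ⟨le_rfl, hθ₁⟩ 0 le_rfl (by positivity) Tw hTw (fun _ _ => 1) isModulation_one U T
    (isDistortedPropagator_one_of_isPropagator hU) (isDistortedPropagator_one_of_isPropagator hT) s t hs hst htT x ζ
  have h0 : (0:ℝ) ^ σ = 0 := Real.zero_rpow hσ.ne'
  rw [zero_div, h0, add_zero, add_zero] at key
  exact key

/-- A capped flat clause without binders implies the one with binders. (`SlowVectorClauseLossFlat` has the UNCAPPED transient; the capped flat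
clause is the `G ≡ 1` slice of `SlowVectorClauseModEC`, whence this bridge is stated from `ModEC`.) -/
theorem lossFlatW_of_modEC {k : ℕ} {W : LatticeShear.LatticeWord k} {M : ℝ} {hM : 0 < M} {c : ℝ}
    {Φ : ℝ → Torus.Visc4 (Fin 3) → Torus.Visc4 (Fin 3)} {lo hi Λ β σ C ν₀ K θ₁ ϱ₁ : ℝ} (hσ : 0 < σ) (hθ₁ : 0 ≤ θ₁) (hϱ₁ : 0 ≤ ϱ₁)
    (h : SlowVectorClauseModEC W M hM c Φ lo hi Λ β σ C ν₀ K θ₁ ϱ₁) : SlowVectorClauseLossFlatW W M hM c Φ lo hi Λ β σ C ν₀ K :=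
  lossFlatW_of_modECW hσ hθ₁ hϱ₁ (modECW_of_modEC h)

end Summit.AnomalousDissipation.AnomalousDissipation.Theorems.SolenoidalFractalHomogenisation.LagrangianStep.CellClauseMod

end
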